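import Mathlib
import HarnessLib
import HarnessLib.Audit
import Summits.HodgeConjecture.HodgeConjecture.Theses.KleimanBFSeeds
import Literature.AlgebraicGeometry.HodgeTheory.WeilFamilyReachSimilarOfSystem
import Literature.AlgebraicGeometry.HodgeTheory.WeilFamilyReachSimilar
import Literature.AlgebraicGeometry.HodgeTheory.WeilFamilyReach
import Literature.AlgebraicGeometry.HodgeTheory.WeilTypeAbelianVariety
import Literature.AlgebraicGeometry.HodgeTheory.WeilClassesRationalPlane
import Literature.AlgebraicGeometry.VanGeemen1994.WeilDiscriminantOfHyperbolic
import Summits.HodgeConjecture.HodgeConjecture.Theorems.Ring2AbelianAllWeilSimilarDiscriminant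
import Literature.AlgebraicGeometry.HodgeTheory.WeilFamilyReachSimilar

/-!
# Skeleton `Lines/moduli-riemann` for crux `SimilarReach` (stmt-HodgeConjecture-23605)

HONEST FRAMING: a crux PROOF SKELETON (cruxes-workfile class), not a proof. The crux
`Theses.KleimanBFSeeds.SimilarReach = weilFamilyReach_similar` (Deligne 1982, proof of Thm. 4.8: a Weil-type anchor and a
Weil-SIMILAR target lie, up to `K`-isogeny, in ONE smooth projective family of abelian `2n`-folds with `√-d`-multiplication
carrying a flat section of Weil classes — a refereed construction typed as an open tree item, formalisation debt: the tree
constructs no moduli space, no universal abelian scheme, no period map) is NOT proved here: the `sorry`s sit exactly inside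
the registered `stub_*` declarations. Nothing here proves K-C⁺, H2, HC_AV or HC.

STRATEGY (line-writer seat `linewriter-hodgeav-h2sheaf` g0, 2026-08-31) — ALGEBRAIC MODULI ⟂ TRANSCENDENTAL RIEMANN.
The venture's bridge (re-proved inline here from Literature theorems, the venture module being outside the farm build) `Summit.Ventures.HSemireg.weilFamilyReach_similar_of_polarizedWeilSystems_of_periodSurjective`
derives the crux from ONE package (`PeriodPackage` below, its hypothesis VERBATIM): through every Weil-type point a polarized
Weil system (smooth projective family, `K`-action, flat Weil sections, polarization class) that is PERIOD-SURJECTIVE (clause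
[U]: every Weil complex structure `J` on `H¹(P)` is the period of some fibre, with a `K`-marking `β`). The bridge itself
already contains the Torelli direction (`hodgeIso_bettiOne_isogeny`: an `H¹`-Hodge-isomorphism is a `K`-isogeny). The package
is ONE existential, so the only sound cut is by the two disciplines in Deligne's pp. 47–51:

* `stub_moduliComplete` — ALGEBRAIC (Riemann-free, XL): the universal family over a connected component of the PEL moduli
  scheme with level structure EXISTS with all the listed properties, and is COMPLETE FOR REALISABLE PERIODS: every Weil complex
  structure `J` that is the `H¹` of SOME abelian variety `B` with `√-d`-multiplication (marked by `β_B`) is the period of a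
  fibre ([MumfordFogartyKirwan1994] Thm. 7.9–7.10 fine moduli with level `m ≥ 3`; the transported Riemann form of `P`
  polarizes `B`; [Deligne1982HodgeCycles] pp. 48–51, Rem. 4.9; [vanGeemen1994HodgeAV] 5.8–5.11 for the flat sections).
* `stub_riemannRealisable` — TRANSCENDENTAL (XL): RIEMANN'S EXISTENCE THEOREM at Weil type — every Weil complex structure `J`
  (positive for the `K`-hermitian form of the datum `weilDatumOfKsymm …`) is realised: `(H¹(P, ℚ), J)` is the `H¹` of an
  abelian variety `B` of dimension `2n` with an endomorphism `Φ`, `Φ² = -d`, intertwined with `ψ₀` by a marking `β`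
  ([Mumford1970AbelianVarieties] §1–§3 (Lefschetz: a polarised torus is algebraic), [BirkenhakeLange2004] Thm. 4.2.1 / §4.5;
  Mathlib: no complex tori, no theta functions; tree: only the converse direction `hodgeIso_bettiOne_isogeny`).
* `periodPackage_of` (PROVED, sorry-free): moduli-complete ∧ Riemann-realisable ⟹ the period-surjective package (modus
  ponens inside the existential; neither stub gives the package or the crux alone: the first has no realisability, the
  second no family).
* `stub_rung_surfaces` — RUNG (special case, first prover target): the crux at `n = 1` — Weil-type abelian SURFACES with
  `√-d`-multiplication (QM/CM surfaces; the families are Shimura CURVES, [Shimura1963AnalyticFamilies] §4, [vanGeemen1994HodgeAV]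
  §5): one-dimensional moduli, smaller but outside the tree's regime (no family of abelian surfaces is constructed in the
  tree). `rung_of_crux` (sorry-free) shows it IS the special case. `stub_rung_riemannSurfaces` is the matching sub-rung of
  the transcendental stub (abelian surfaces, `m = 1`).

COMPOSITION `SimilarReach_of := similar_of_periodPackage (periodPackage_of stub_moduliComplete stub_riemannRealisable)`.

References: [Deligne1982HodgeCycles] §4 Prop. 4.4, Lemma 4.6, proof of Thm. 4.8 (pp. 47–52), Rem. 4.9;
[vanGeemen1994HodgeAV] Lemma 5.2, 5.3–5.5, 5.8–5.11; [MumfordFogartyKirwan1994] Thm. 7.9–7.10; [Mumford1970AbelianVarieties]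
§1–§3; [BirkenhakeLange2004] Thm. 4.2.1; [Milne1986AbelianVarieties] §8 Prop. 8.1; [Landherr1936HermitianForms];
[Shimura1963AnalyticFamilies].
-/

-- every declaration of this problem lives in `Summit.HodgeConjecture.HodgeConjecture.…` (summit = sub-problem)
set_option linter.dupNamespace false

noncomputable section

open CategoryTheory AlgebraicGeometry
open scoped TensorProduct
open Literature.AlgebraicGeometry Literature.AlgebraicGeometry.Motives
open Literature.AlgebraicGeometry.HodgeTheory
open Literature.AlgebraicGeometry.VanGeemen1994
open Literature.AlgebraicTopology.SingularHomology
open Summit.HodgeConjecture.HodgeConjecture.Ring2.AbelianAll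

namespace Summit.HodgeConjecture.HodgeConjecture.Cruxes.SimilarReach.ModuliRiemann

/-- RIEMANN REALISABILITY of one Weil complex structure `J` on the datum of `(P, ψ₀, h_K, ω)`: `(H¹(P, ℚ), J)` is the `H¹` of
an abelian variety `B` of dimension `2n` with `Φ² = -d`, marked by `β` intertwining `ψ₀` and `Φ` and carrying the
`(1,0)`-piece of `J` into `H^{1,0}(B)`. [cite: Mumford1970AbelianVarieties, §1–§3] [cite: BirkenhakeLange2004, Thm. 4.2.1] -/
def RealisedBy (n d : ℕ) (P : AbelianVariety ℂ) (ψ₀ : P ⟶ P) (e : ProjectiveEmbedding P.X)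
    {a : complexBetti (projectiveSpace e.n ℂ) 2} (ha : IsRationalClass a) (ha0 : a ≠ 0)
    {m : ℕ} (hm : 1 ≤ m) (hPm : P.dim = m + 1) (hd' : 0 < d) (hψ : ψ₀ ≫ ψ₀ = -(d • 𝟙 P))
    {ω : complexBetti P.X (2 + 2 * m)} (hω : IsRationalClass ω) (hω0 : ω ≠ 0)
    (J : (weilDatumOfKsymm hm hPm hd' hψ e ha ha0 hω hω0).Cx →ₗ[ℂ] (weilDatumOfKsymm hm hPm hd' hψ e ha ha0 hω hω0).Cx)
    (hW : Motives.IsWeilComplexStructure (weilDatumOfKsymm hm hPm hd' hψ e ha ha0 hω hω0).hForm J)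
    (B : AbelianVariety ℂ) (Φ : B ⟶ B) (β : bettiCohomology P.X 1 ≃ₗ[ℚ] bettiCohomology B.X 1) : Prop :=
  B.dim = 2 * n ∧ Φ ≫ Φ = -((d : ℤ) • 𝟙 B) ∧
    (∀ x, β (bettiCohomology.map ψ₀.hom.hom.hom 1 x) = bettiCohomology.map Φ.hom.hom.hom 1 (β x)) ∧
    ∀ x ∈ ((weilDatumOfKsymm hm hPm hd' hψ e ha ha0 hω hω0).hodgeStructure J hW.sq).piece 1 0,
      IsOfHodgeType (2 * n) B.X 1 1 0
        (Motives.ofRatClassBaseChange (ComplexPoints B.X) 1 (β.toLinearMap.baseChange ℂ x))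

/-- RIEMANN'S EXISTENCE THEOREM AT WEIL TYPE `(n, n)`, discriminant `d` (statement of the transcendental stub). -/
def RiemannRealisableAt (n d : ℕ) : Prop :=
  ∀ (P : AbelianVariety ℂ) (ψ₀ : P ⟶ P) (e : ProjectiveEmbedding P.X) (a : complexBetti (projectiveSpace e.n ℂ) 2),
    P.dim = 2 * n → ∀ (ha : IsRationalClass a) (ha0 : a ≠ 0), IsWeilType P ψ₀ n d →
    ∀ {m : ℕ} (hm : 1 ≤ m) (hPm : P.dim = m + 1) (hd' : 0 < d) (hψ : ψ₀ ≫ ψ₀ = -(d • 𝟙 P))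
      {ω : complexBetti P.X (2 + 2 * m)} (hω : IsRationalClass ω) (hω0 : ω ≠ 0)
      (J : (weilDatumOfKsymm hm hPm hd' hψ e ha ha0 hω hω0).Cx →ₗ[ℂ] (weilDatumOfKsymm hm hPm hd' hψ e ha ha0 hω hω0).Cx)
      (hW : Motives.IsWeilComplexStructure (weilDatumOfKsymm hm hPm hd' hψ e ha ha0 hω hω0).hForm J),
      ∃ (B : AbelianVariety ℂ) (Φ : B ⟶ B) (β : bettiCohomology P.X 1 ≃ₗ[ℚ] bettiCohomology B.X 1),
        RealisedBy n d P ψ₀ e ha ha0 hm hPm hd' hψ hω hω0 J hW B Φ β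

/-- THE PERIOD-SURJECTIVE PACKAGE — VERBATIM the hypothesis of the venture's bridge
`weilFamilyReach_similar_of_polarizedWeilSystems_of_periodSurjective`. [cite: Deligne1982HodgeCycles, proof of Thm. 4.8] -/
def PeriodPackage : Prop :=
  ∀ (n d : ℕ), 1 ≤ n → 1 ≤ d →
      ∀ (P : AbelianVariety ℂ) (ψ₀ : P ⟶ P) (e : ProjectiveEmbedding P.X)
        (a : complexBetti (projectiveSpace e.n ℂ) 2),
        P.dim = 2 * n → ∀ (ha : IsRationalClass a) (ha0 : a ≠ 0), IsWeilType P ψ₀ n d →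
        ∃ (𝒳 S : SchemeOver ℂ) (f : 𝒳 ⟶ S) (s₀ : ComplexPoints S) (e' : P.X ≅ fiberOver f s₀)
          (Y : ComplexPoints S → AbelianVariety ℂ) (Ψ : ∀ s, Y s ⟶ Y s)
          (ε : ∀ s, (Y s).X ≅ fiberOver f s) (H : complexBetti 𝒳 2),
          IsSmoothProjectiveFamily f (2 * n) ∧
          (∃ (N : ℕ) (ι : 𝒳 ⟶ CategoryTheory.MonoidalCategoryStruct.tensorObj (projectiveSpace N ℂ) S),
            AlgebraicGeometry.IsClosedImmersion ι.left ∧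
              ι ≫ CategoryTheory.CartesianMonoidalCategory.snd (projectiveSpace N ℂ) S = f) ∧
          IrreducibleSpace S.left ∧ AlgebraicGeometry.Smooth S.hom ∧ IsQuasiProjectiveOver S ∧
          (∀ s, (Y s).dim = 2 * n ∧ Ψ s ≫ Ψ s = -((d : ℤ) • 𝟙 (Y s))) ∧
          (∀ w : complexBetti P.X (2 * n), w ∈ weilClassesOf P ψ₀ n d →
            ∃ σ : ComplexPoints S → FiberClass f (2 * n),
              Continuous σ ∧ σ s₀ = ⟨s₀, complexBetti.map e'.inv (2 * n) w⟩ ∧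
              ∀ s, ∃ x : complexBetti (fiberOver f s) (2 * n), σ s = ⟨s, x⟩ ∧
                IsOfHodgeType (2 * n) (fiberOver f s) (2 * n) n n x ∧
                complexBetti.map (ε s).hom (2 * n) x ∈ weilClassesOf (Y s) (Ψ s) n d) ∧
          (∀ s : ComplexPoints S,
            IsRationalClass (complexBetti.map (fiberι f s) 2 H) ∧
              IsOfHodgeType (2 * n) (fiberOver f s) 2 1 1 (complexBetti.map (fiberι f s) 2 H)) ∧
          complexBetti.map e'.hom 2 (complexBetti.map (fiberι f s₀) 2 H) =
            (d : ℂ) • complexBetti.map e.ι 2 a + complexBetti.map ψ₀.hom.hom.hom 2 (complexBetti.map e.ι 2 a) ∧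
          (∃ (m : ℕ) (hm : 1 ≤ m) (hPm : P.dim = m + 1) (hd' : 0 < d) (hψ : ψ₀ ≫ ψ₀ = -(d • 𝟙 P))
              (ω : complexBetti P.X (2 + 2 * m)) (hω : IsRationalClass ω) (hω0 : ω ≠ 0),
            ∀ (J : (weilDatumOfKsymm hm hPm hd' hψ e ha ha0 hω hω0).Cx →ₗ[ℂ]
                (weilDatumOfKsymm hm hPm hd' hψ e ha ha0 hω hω0).Cx)
              (hW : Motives.IsWeilComplexStructure (weilDatumOfKsymm hm hPm hd' hψ e ha ha0 hω hω0).hForm J),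
              ∃ (s : ComplexPoints S) (β : bettiCohomology P.X 1 ≃ₗ[ℚ] bettiCohomology (Y s).X 1),
                (∀ x, β (bettiCohomology.map ψ₀.hom.hom.hom 1 x) =
                  bettiCohomology.map (Ψ s).hom.hom.hom 1 (β x)) ∧
                ∀ x ∈ ((weilDatumOfKsymm hm hPm hd' hψ e ha ha0 hω hω0).hodgeStructure J hW.sq).piece 1 0,
                  IsOfHodgeType (2 * n) (Y s).X 1 1 0
                    (Motives.ofRatClassBaseChange (ComplexPoints (Y s).X) 1 (β.toLinearMap.baseChange ℂ x)))

/-- THE ALGEBRAIC HALF (statement of the Riemann-free stub): the same package, but period-surjective only for REALISABLE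
periods — a universal family COMPLETE for abelian varieties with `√-d`-multiplication marked on `H¹(P)`.
[cite: MumfordFogartyKirwan1994, Thm. 7.9–7.10] [cite: Deligne1982HodgeCycles, proof of Thm. 4.8 (pp. 48–51) and Rem. 4.9] -/
def ModuliCompletePackage : Prop :=
  ∀ (n d : ℕ), 1 ≤ n → 1 ≤ d →
      ∀ (P : AbelianVariety ℂ) (ψ₀ : P ⟶ P) (e : ProjectiveEmbedding P.X)
        (a : complexBetti (projectiveSpace e.n ℂ) 2),
        P.dim = 2 * n → ∀ (ha : IsRationalClass a) (ha0 : a ≠ 0), IsWeilType P ψ₀ n d →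
        ∃ (𝒳 S : SchemeOver ℂ) (f : 𝒳 ⟶ S) (s₀ : ComplexPoints S) (e' : P.X ≅ fiberOver f s₀)
          (Y : ComplexPoints S → AbelianVariety ℂ) (Ψ : ∀ s, Y s ⟶ Y s)
          (ε : ∀ s, (Y s).X ≅ fiberOver f s) (H : complexBetti 𝒳 2),
          IsSmoothProjectiveFamily f (2 * n) ∧
          (∃ (N : ℕ) (ι : 𝒳 ⟶ CategoryTheory.MonoidalCategoryStruct.tensorObj (projectiveSpace N ℂ) S),
            AlgebraicGeometry.IsClosedImmersion ι.left ∧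
              ι ≫ CategoryTheory.CartesianMonoidalCategory.snd (projectiveSpace N ℂ) S = f) ∧
          IrreducibleSpace S.left ∧ AlgebraicGeometry.Smooth S.hom ∧ IsQuasiProjectiveOver S ∧
          (∀ s, (Y s).dim = 2 * n ∧ Ψ s ≫ Ψ s = -((d : ℤ) • 𝟙 (Y s))) ∧
          (∀ w : complexBetti P.X (2 * n), w ∈ weilClassesOf P ψ₀ n d →
            ∃ σ : ComplexPoints S → FiberClass f (2 * n),
              Continuous σ ∧ σ s₀ = ⟨s₀, complexBetti.map e'.inv (2 * n) w⟩ ∧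
              ∀ s, ∃ x : complexBetti (fiberOver f s) (2 * n), σ s = ⟨s, x⟩ ∧
                IsOfHodgeType (2 * n) (fiberOver f s) (2 * n) n n x ∧
                complexBetti.map (ε s).hom (2 * n) x ∈ weilClassesOf (Y s) (Ψ s) n d) ∧
          (∀ s : ComplexPoints S,
            IsRationalClass (complexBetti.map (fiberι f s) 2 H) ∧
              IsOfHodgeType (2 * n) (fiberOver f s) 2 1 1 (complexBetti.map (fiberι f s) 2 H)) ∧
          complexBetti.map e'.hom 2 (complexBetti.map (fiberι f s₀) 2 H) =
            (d : ℂ) • complexBetti.map e.ι 2 a + complexBetti.map ψ₀.hom.hom.hom 2 (complexBetti.map e.ι 2 a) ∧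
          (∃ (m : ℕ) (hm : 1 ≤ m) (hPm : P.dim = m + 1) (hd' : 0 < d) (hψ : ψ₀ ≫ ψ₀ = -(d • 𝟙 P))
              (ω : complexBetti P.X (2 + 2 * m)) (hω : IsRationalClass ω) (hω0 : ω ≠ 0),
            ∀ (J : (weilDatumOfKsymm hm hPm hd' hψ e ha ha0 hω hω0).Cx →ₗ[ℂ]
                (weilDatumOfKsymm hm hPm hd' hψ e ha ha0 hω hω0).Cx)
              (hW : Motives.IsWeilComplexStructure (weilDatumOfKsymm hm hPm hd' hψ e ha ha0 hω hω0).hForm J),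
              (∃ (B : AbelianVariety ℂ) (Φ : B ⟶ B) (β : bettiCohomology P.X 1 ≃ₗ[ℚ] bettiCohomology B.X 1),
                  RealisedBy n d P ψ₀ e ha ha0 hm hPm hd' hψ hω hω0 J hW B Φ β) →
              ∃ (s : ComplexPoints S) (β : bettiCohomology P.X 1 ≃ₗ[ℚ] bettiCohomology (Y s).X 1),
                (∀ x, β (bettiCohomology.map ψ₀.hom.hom.hom 1 x) =
                  bettiCohomology.map (Ψ s).hom.hom.hom 1 (β x)) ∧
                ∀ x ∈ ((weilDatumOfKsymm hm hPm hd' hψ e ha ha0 hω hω0).hodgeStructure J hW.sq).piece 1 0,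
                  IsOfHodgeType (2 * n) (Y s).X 1 1 0
                    (Motives.ofRatClassBaseChange (ComplexPoints (Y s).X) 1 (β.toLinearMap.baseChange ℂ x)))

/-- STUB (open, load-bearing, XL): the ALGEBRAIC half — fine PEL moduli with level structure, its universal family with
flat Weil sections and polarization class, complete for realisable periods. [cite: MumfordFogartyKirwan1994, Thm. 7.9–7.10]
[cite: Deligne1982HodgeCycles, proof of Thm. 4.8 (pp. 48–51) and Rem. 4.9] [cite: vanGeemen1994HodgeAV, 5.8–5.11] -/
theorem stub_moduliComplete : ModuliCompletePackage := by
  sorry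

/-- STUB (open, load-bearing, XL): the TRANSCENDENTAL half — Riemann's existence theorem at Weil type, every `n, d ≥ 1`.
[cite: Mumford1970AbelianVarieties, §1–§3] [cite: BirkenhakeLange2004, Thm. 4.2.1] [cite: Deligne1982HodgeCycles, Prop. 4.4 and Lemma 4.6] -/
theorem stub_riemannRealisable : ∀ (n d : ℕ), 1 ≤ n → 1 ≤ d → RiemannRealisableAt n d := by
  sorry

/-- GLUE (proved): moduli-complete ∧ Riemann-realisable ⟹ the period-surjective package. -/
theorem periodPackage_of (hM : ModuliCompletePackage) (hR : ∀ (n d : ℕ), 1 ≤ n → 1 ≤ d → RiemannRealisableAt n d) :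
    PeriodPackage := by
  intro n d hn hd P ψ₀ e a hP ha ha0 hWT
  obtain ⟨𝒳, S, f, s₀, e', Y, Ψ, ε, H, h1, h2, h3, h4, h5, h6, h7, h8, h9, m, hm, hPm, hd', hψ, ω, hω, hω0, hU⟩ :=
    hM n d hn hd P ψ₀ e a hP ha ha0 hWT
  exact ⟨𝒳, S, f, s₀, e', Y, Ψ, ε, H, h1, h2, h3, h4, h5, h6, h7, h8, h9, m, hm, hPm, hd', hψ, ω, hω, hω0,
    fun J hW => hU J hW (hR n d hn hd P ψ₀ e a hP ha ha0 hWT hm hPm hd' hψ hω hω0 J hW)⟩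

/-- RUNG STUB (open, first prover target, L): the crux at `n = 1` — Weil-type abelian SURFACES (families = Shimura curves).
[cite: Shimura1963AnalyticFamilies, §4] [cite: vanGeemen1994HodgeAV, §5] [cite: Deligne1982HodgeCycles, proof of Thm. 4.8] -/
theorem stub_rung_surfaces :
    ∀ (d : ℕ), 1 ≤ d →
    ∀ (P : AbelianVariety ℂ) (ψ₀ : P ⟶ P) (e : ProjectiveEmbedding P.X)
      (a : complexBetti (projectiveSpace e.n ℂ) 2),
      P.dim = 2 * 1 → ψ₀ ≫ ψ₀ = -(d • 𝟙 P) → IsRationalClass a → a ≠ 0 →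
    ∀ w : complexBetti P.X (2 * 1),
      w ∈ weilClassesOf P ψ₀ 1 d → w ≠ 0 → IsOfHodgeType (2 * 1) P.X (2 * 1) 1 1 w →
    ∀ (A : AbelianVariety ℂ) (φ : A ⟶ A) (eA : ProjectiveEmbedding A.X)
      (aA : complexBetti (projectiveSpace eA.n ℂ) 2),
      A.dim = 2 * 1 → φ ≫ φ = -(d • 𝟙 A) → IsRationalClass aA → aA ≠ 0 →
      (∃ wA : complexBetti A.X (2 * 1),
        wA ∈ weilClassesOf A φ 1 d ∧ wA ≠ 0 ∧ IsOfHodgeType (2 * 1) A.X (2 * 1) 1 1 wA) →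
      Motives.IsWeilSimilar 1 P ψ₀
          ((d : ℂ) • complexBetti.map e.ι 2 a + complexBetti.map ψ₀.hom.hom.hom 2 (complexBetti.map e.ι 2 a))
          A φ
          ((d : ℂ) • complexBetti.map eA.ι 2 aA +
            complexBetti.map φ.hom.hom.hom 2 (complexBetti.map eA.ι 2 aA)) →
      WeilFamilyReaches 1 d P
        ((d : ℂ) • complexBetti.map e.ι 2 a + complexBetti.map ψ₀.hom.hom.hom 2 (complexBetti.map e.ι 2 a))
        w A φ := by
  sorry

/-- Remark (sorry-free): the rung IS the crux at `n = 1`. -/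
theorem rung_of_crux (h : Summit.HodgeConjecture.HodgeConjecture.Theses.KleimanBFSeeds.SimilarReach) :
    ∀ (d : ℕ), 1 ≤ d →
    ∀ (P : AbelianVariety ℂ) (ψ₀ : P ⟶ P) (e : ProjectiveEmbedding P.X)
      (a : complexBetti (projectiveSpace e.n ℂ) 2),
      P.dim = 2 * 1 → ψ₀ ≫ ψ₀ = -(d • 𝟙 P) → IsRationalClass a → a ≠ 0 →
    ∀ w : complexBetti P.X (2 * 1),
      w ∈ weilClassesOf P ψ₀ 1 d → w ≠ 0 → IsOfHodgeType (2 * 1) P.X (2 * 1) 1 1 w →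
    ∀ (A : AbelianVariety ℂ) (φ : A ⟶ A) (eA : ProjectiveEmbedding A.X)
      (aA : complexBetti (projectiveSpace eA.n ℂ) 2),
      A.dim = 2 * 1 → φ ≫ φ = -(d • 𝟙 A) → IsRationalClass aA → aA ≠ 0 →
      (∃ wA : complexBetti A.X (2 * 1),
        wA ∈ weilClassesOf A φ 1 d ∧ wA ≠ 0 ∧ IsOfHodgeType (2 * 1) A.X (2 * 1) 1 1 wA) →
      Motives.IsWeilSimilar 1 P ψ₀
          ((d : ℂ) • complexBetti.map e.ι 2 a + complexBetti.map ψ₀.hom.hom.hom 2 (complexBetti.map e.ι 2 a))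
          A φ
          ((d : ℂ) • complexBetti.map eA.ι 2 aA +
            complexBetti.map φ.hom.hom.hom 2 (complexBetti.map eA.ι 2 aA)) →
      WeilFamilyReaches 1 d P
        ((d : ℂ) • complexBetti.map e.ι 2 a + complexBetti.map ψ₀.hom.hom.hom 2 (complexBetti.map e.ι 2 a))
        w A φ :=
  fun d hd => h 1 d le_rfl hd

/-- SUB-RUNG STUB (open, de-risks the transcendental stub): Riemann realisability for Weil-type abelian SURFACES. -/
theorem stub_rung_riemannSurfaces : ∀ (d : ℕ), 1 ≤ d → RiemannRealisableAt 1 d := by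
  sorry

/-- Remark (sorry-free): the sub-rung IS the `n = 1` case of the transcendental stub's statement. -/
theorem subrung_of_stub (h : ∀ (n d : ℕ), 1 ≤ n → 1 ≤ d → RiemannRealisableAt n d) :
    ∀ (d : ℕ), 1 ≤ d → RiemannRealisableAt 1 d :=
  fun d hd => h 1 d le_rfl hd

/-- THE BRIDGE (proved; the venture's `Summit.Ventures.HSemireg.weilFamilyReach_similar_of_polarizedWeilSystems_of_periodSurjective`
re-proved inline because that venture module is outside the farm build): the period-surjective package gives the reach
fact by similitude. [cite: Deligne1982HodgeCycles, proof of Thm. 4.8] [cite: vanGeemen1994HodgeAV, Lemma 5.2] -/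
theorem similar_of_periodPackage (h : PeriodPackage) : weilFamilyReach_similar := by
  intro n d hn hd P ψ₀ e a hP hψ ha ha0 w hw hw0 hwH A φ eA aA hA hφ haA haA0 hweilA hsim
  have hn0 : 0 < n := hn
  have hd0 : 0 < d := hd
  have hWP : IsWeilType P ψ₀ n d := isWeilType_of_weilClass_ne_zero hn0 hd0 hP hψ hw hw0 hwH
  obtain ⟨𝒳, S, f, s₀, e', Y, Ψ, ε, H, hfam, hemb, hirr, hsm, hqp, hYΨ, hsec, hH, hH₀, hU⟩ :=
    h n d hn hd P ψ₀ e a hP ha ha0 hWP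
  obtain ⟨δ, hδP⟩ := exists_hasWeilDiscriminantNondeg hn0 hP hd0 hψ e ha ha0
  have hδA := hasWeilDiscriminantNondeg_of_isWeilSimilar hn0 hP hA hsim hδP
  obtain ⟨wA, hwA, hwA0, hwAH⟩ := hweilA
  exact weilFamilyReaches_of_polarizedWeilSystemAt_of_periodSurjective hn hP e ha ha0 ⟨w, hw, hw0, hwH⟩ hδP
    f e' Y Ψ ε hfam hemb hirr hsm hqp hYΨ hsec hH hH₀ hU hA hφ eA haA haA0 ⟨wA, hwA, hwA0, hwAH⟩ hδA hw hw0

/-- **Composition** (the ONLY theorem of this file concluding the crux): the two halves give `SimilarReach` BY NAME. -/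
theorem SimilarReach_of :
    Summit.HodgeConjecture.HodgeConjecture.Theses.KleimanBFSeeds.SimilarReach :=
  similar_of_periodPackage (periodPackage_of stub_moduliComplete stub_riemannRealisable)

end Summit.HodgeConjecture.HodgeConjecture.Cruxes.SimilarReach.ModuliRiemann

end
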